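import Summits.AtomisticToContinuum.HydrodynamicLimit.Theorems.CollisionIsometryCLTAdaptedWeightCLTBHEEPClosureCell
import Summits.AtomisticToContinuum.HydrodynamicLimit.Theorems.CollisionIsometryCLTAdaptedWeightCLTBHEEPClosureMeasurable

/-!
# Stub `stub_eepClosure` (S5) of the line `block-h-dissipation-closure`, helper file 11: the POINTWISE SPLIT of the
crux integrand at cell scale and its integration along a good orbit
(crux `CollisionIsometryCLT.AdaptedWeightCLT`, stmt-AtomisticToContinuum-14868; `--supports`)

Step (v) of the planner's sketch of `stub_eepClosure`. At every `(s, x)` the crux integrand is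
`DefectSq = ρ̄² · cloudDefect` (helper 3); splitting the cells into GOOD ones (cell Gaussian moment `≤ R` and
`𝒟h(f̂) ≤ κ`, where the cell closure of helper 9 gives `cloudDefect ≤ ε`) and BAD ones (charged either to the Gaussian
moment, `1 ≤ Mexp/R`, or to the dissipation, `1 ≤ 𝒟h/κ`, through the uniform-integrability envelope
`cloudDefect ≤ 1024 Σ p_i (1 + |v_i|⁶) ≤ 1024 (L_c + η Mexp)` of helper 3 and the UI split `exists_ui_split`), and using the
hard-core density cap `ρ̄ ≤ ρ_max` on ONE factor `ρ̄`, gives POINTWISE (`defectSq_le_pointwise`)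
`DefectSq ≤ ρ_max (ε ρ̄ + 1024 (L_c/R + η) · ρ̄ Mexp + (1024 L_c/κ) · ρ̄ 𝒟h(f̂))`,
whose three densities integrate over `x` to `1`, to the empirical Gaussian moment, and to the `massDiss` density.
Integrating over `[0, t] × 𝕋³` along a good orbit (all four functions have genuine iterated integrals, helper 10 and
the landed `Reduction.integrable_of_bdd`) gives the PATHWISE BOUND (`setIntegral_defectSq_le`)
`∫₀ᵗ∫ₓ DefectSq ≤ ρ_max (ε t + 1024 (L_c/R + η) · TE + (1024 L_c/κ) · massDiss)`, `TE` the time-integrated empirical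
Gaussian moment of `TailsOn`. No definitions. Registered anchor: `bhEEPClosure_pointwise_anchor` (the UI split).
-/

namespace Summit.AtomisticToContinuum.HydrodynamicLimit.Theorems.BlockHDissipation

open scoped BigOperators Topology Classical MeasureTheory ENNReal InnerProductSpace
open Filter Set MeasureTheory Real
open Literature.Analysis.FluidPDE
open Summit.AtomisticToContinuum.HydrodynamicLimit.Theorems.ContactSourceDuhamel (T3 V3 Cfg Vel Flow Flows wgt DefectSq)
open Summit.AtomisticToContinuum.HydrodynamicLimit.Theorems.ContactSourceDuhamel.TimeLocal (AdmissibleKernel)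
open Summit.AtomisticToContinuum.HydrodynamicLimit.Theorems.ContactSourceDuhamel.TimeLocal.Reduction
  (measurable_flow_of_mem_good integrable_of_bdd vR norm_vel_flow_le measurable_defectSq bdd_defectSq
  integral_empiricalMeasure_real isFiniteMeasure_volume_T3)
open Literature.MathematicalPhysics.KineticTheory (collide hardSphereKernel sphereMeasure)

noncomputable section

namespace EEP

variable {N : ℕ} {ψ : ℕ → T3 → ℝ}

/-! ## The uniform-integrability split of the sixth moment -/

/-- `1 + u³ ≤ (1 + V³) + (6 e^μ/μ³) e^{−μV} e^{2μ u}` for `u, V ≥ 0 < μ`: below `V` by monotonicity, above `V` by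
`(1 + u)³ ≤ (6e^μ/μ³) e^{μu}` and `e^{μu} ≤ e^{−μV} e^{2μu}`. -/
theorem one_add_cube_le_split {μ u V : ℝ} (hμ : 0 < μ) (hu : 0 ≤ u) (hV : 0 ≤ V) :
    1 + u ^ 3 ≤ (1 + V ^ 3) + 6 * Real.exp μ / μ ^ 3 * Real.exp (-(μ * V)) * Real.exp (2 * μ * u) := by
  have hA : 0 ≤ 6 * Real.exp μ / μ ^ 3 := by positivity
  have htail : 0 ≤ 6 * Real.exp μ / μ ^ 3 * Real.exp (-(μ * V)) * Real.exp (2 * μ * u) := by positivity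
  rcases le_or_gt u V with h | h
  · have : u ^ 3 ≤ V ^ 3 := pow_le_pow_left₀ hu h 3
    linarith
  · have h1 : 1 + u ^ 3 ≤ (1 + u) ^ 3 := by nlinarith [sq_nonneg u, mul_nonneg hu (sq_nonneg u)]
    have h2 := one_add_pow_three_le_exp hμ hu
    have h3 : Real.exp (μ * u) ≤ Real.exp (-(μ * V)) * Real.exp (2 * μ * u) := by
      rw [← Real.exp_add, Real.exp_le_exp]; nlinarith [mul_le_mul_of_nonneg_left h.le hμ.le]
    have h4 : 6 * Real.exp μ / μ ^ 3 * Real.exp (μ * u) ≤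
        6 * Real.exp μ / μ ^ 3 * (Real.exp (-(μ * V)) * Real.exp (2 * μ * u)) := mul_le_mul_of_nonneg_left h3 hA
    have h5 : 0 ≤ 1 + V ^ 3 := by positivity
    calc 1 + u ^ 3 ≤ (1 + u) ^ 3 := h1
      _ ≤ 6 * Real.exp μ / μ ^ 3 * Real.exp (μ * u) := h2
      _ ≤ (1 + V ^ 3) + 6 * Real.exp μ / μ ^ 3 * Real.exp (-(μ * V)) * Real.exp (2 * μ * u) := by linarith

/-- **UI SPLIT**: for `λ > 0` and every `η > 0` there is `L_c ≥ 0` with `1 + |v|⁶ ≤ L_c + η e^{λ|v|²}` for all `v`. -/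
theorem exists_ui_split {lam : ℝ} (hlam : 0 < lam) {η : ℝ} (hη : 0 < η) :
    ∃ Lc : ℝ, 0 ≤ Lc ∧ ∀ v : V3, 1 + ‖v‖ ^ 6 ≤ Lc + η * Real.exp (lam * ‖v‖ ^ 2) := by
  set μ : ℝ := lam / 2 with hμ
  have hμ0 : 0 < μ := by positivity
  set A : ℝ := 6 * Real.exp μ / μ ^ 3 with hA
  have hA0 : 0 < A := by positivity
  -- choose `V ≥ 0` with `A e^{−μV} ≤ η`
  obtain ⟨V, hV0, hV⟩ : ∃ V : ℝ, 0 ≤ V ∧ A * Real.exp (-(μ * V)) ≤ η := by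
    refine ⟨max 0 (Real.log (A / η) / μ), le_max_left _ _, ?_⟩
    have h1 : Real.log (A / η) / μ ≤ max 0 (Real.log (A / η) / μ) := le_max_right _ _
    have h2 : Real.log (A / η) ≤ μ * max 0 (Real.log (A / η) / μ) := by
      rw [div_le_iff₀ hμ0] at h1; linarith
    have h3 : Real.exp (-(μ * max 0 (Real.log (A / η) / μ))) ≤ Real.exp (-Real.log (A / η)) :=
      Real.exp_le_exp.2 (by linarith)
    have h4 : Real.exp (-Real.log (A / η)) = (A / η)⁻¹ := by rw [Real.exp_neg, Real.exp_log (div_pos hA0 hη)]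
    rw [h4] at h3
    calc A * Real.exp (-(μ * max 0 (Real.log (A / η) / μ))) ≤ A * (A / η)⁻¹ := mul_le_mul_of_nonneg_left h3 hA0.le
      _ = η := by field_simp
  refine ⟨1 + V ^ 3, by positivity, fun v => ?_⟩
  have h := one_add_cube_le_split (u := ‖v‖ ^ 2) hμ0 (sq_nonneg _) hV0
  have h6 : (‖v‖ ^ 2) ^ 3 = ‖v‖ ^ 6 := by ring
  have h2μ : 2 * μ * ‖v‖ ^ 2 = lam * ‖v‖ ^ 2 := by rw [hμ]; ring
  rw [h6, h2μ] at h
  have hexp : 0 ≤ Real.exp (lam * ‖v‖ ^ 2) := (Real.exp_pos _).le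
  calc 1 + ‖v‖ ^ 6 ≤ (1 + V ^ 3) + A * Real.exp (-(μ * V)) * Real.exp (lam * ‖v‖ ^ 2) := h
    _ ≤ (1 + V ^ 3) + η * Real.exp (lam * ‖v‖ ^ 2) := by nlinarith [mul_le_mul_of_nonneg_right hV hexp]

/-! ## The pointwise split at one cell -/

section Pointwise

variable (hψ0 : ∀ N y, 0 ≤ ψ N y) {h δ : ℝ} (hδ0 : 0 ≤ δ) (hδ1 : δ ≤ 1)
include hψ0 hδ0 hδ1

/-- **THE POINTWISE SPLIT** at the cell `(w, x)`: with the cell closure property `hcell` (good cells), the UI split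
`hUI` (bad cells) and the density cap `ρ̄ ≤ ρ_max`:
`ρ̄² cloudDefect ≤ ρ_max (ε ρ̄ + 1024 (L_c/R + η) · (N+1)⁻¹ Σ_i ψ_i e^{λ|v_i|²} + (1024 L_c/κ) · ρ̄ 𝒟h(f̂))`. -/
theorem rho_sq_mul_cloudDefect_le (w : Cfg N) (x : T3) {ρmax ε R κ Lc η lam : ℝ} (hR : 0 < R) (hκ : 0 < κ)
    (hε : 0 ≤ ε) (hLc : 0 ≤ Lc) (hη : 0 ≤ η) (hρmax : 0 ≤ ρmax)
    (hcap : ((N + 1 : ℕ) : ℝ)⁻¹ * cW N ψ w x ≤ ρmax)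
    (hUI : ∀ v : V3, 1 + ‖v‖ ^ 6 ≤ Lc + η * Real.exp (lam * ‖v‖ ^ 2))
    (hcell : ∀ (n : ℕ) (p : Fin n → ℝ) (v : Fin n → V3), (∀ i, 0 ≤ p i) → ∑ i, p i = 1 →
      ∑ i, p i * Real.exp (lam * ‖v i‖ ^ 2) ≤ R → hellDiss (cloudLaw h δ p v) ≤ κ → cloudDefect p v ≤ ε) :
    (((N + 1 : ℕ) : ℝ)⁻¹ * cW N ψ w x) ^ 2 * cloudDefect (cellProb N ψ w x) (cellVel w) ≤
      ρmax * (ε * (((N + 1 : ℕ) : ℝ)⁻¹ * cW N ψ w x) +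
        1024 * (Lc / R + η) * (((N + 1 : ℕ) : ℝ)⁻¹ * ∑ i, cw N ψ w x i * Real.exp (lam * ‖(w i).2‖ ^ 2)) +
        1024 * Lc / κ * (((N + 1 : ℕ) : ℝ)⁻¹ * cW N ψ w x * hellDiss (cellLaw N ψ h δ w x))) := by
  set ρ : ℝ := ((N + 1 : ℕ) : ℝ)⁻¹ * cW N ψ w x with hρ
  have hW0 : 0 ≤ cW N ψ w x := Finset.sum_nonneg fun i _ => hψ0 N _
  have hρ0 : 0 ≤ ρ := mul_nonneg (by positivity) hW0
  have hD0 : 0 ≤ hellDiss (cellLaw N ψ h δ w x) := (ContactToMass.hellDiss_cellLaw_mem_Icc hψ0 hδ0 hδ1 h w x).1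
  have hEM0 : 0 ≤ ((N + 1 : ℕ) : ℝ)⁻¹ * ∑ i, cw N ψ w x i * Real.exp (lam * ‖(w i).2‖ ^ 2) :=
    mul_nonneg (by positivity) (Finset.sum_nonneg fun i _ => mul_nonneg (hψ0 N _) (Real.exp_pos _).le)
  have hRHS0 : 0 ≤ ρmax * (ε * ρ + 1024 * (Lc / R + η) *
      (((N + 1 : ℕ) : ℝ)⁻¹ * ∑ i, cw N ψ w x i * Real.exp (lam * ‖(w i).2‖ ^ 2)) +
      1024 * Lc / κ * (ρ * hellDiss (cellLaw N ψ h δ w x))) := by positivity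
  by_cases hW : cW N ψ w x = 0
  · -- empty cell: `ρ̄ = 0`
    have hρz : ρ = 0 := by rw [hρ, hW, mul_zero]
    rw [hρz, zero_pow two_ne_zero, zero_mul]
    rw [hρz] at hRHS0
    exact hRHS0
  · -- nonempty cell: a probability cloud
    set p := cellProb N ψ w x with hp
    set vel := cellVel w with hvel
    have hp0 : ∀ i, 0 ≤ p i := cellProb_nonneg ψ w x hψ0
    have hp1 : ∑ i, p i = 1 := sum_cellProb ψ w x hW
    set Mexp : ℝ := ∑ i, p i * Real.exp (lam * ‖vel i‖ ^ 2) with hMexp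
    have hMexp0 : 0 ≤ Mexp := Finset.sum_nonneg fun i _ => mul_nonneg (hp0 i) (Real.exp_pos _).le
    have hEM : ((N + 1 : ℕ) : ℝ)⁻¹ * ∑ i, cw N ψ w x i * Real.exp (lam * ‖(w i).2‖ ^ 2) = ρ * Mexp := by
      rw [hρ, hMexp, mul_assoc, sum_cw_mul_eq ψ w x hψ0]; rfl
    have hDeq : hellDiss (cellLaw N ψ h δ w x) = hellDiss (cloudLaw h δ p vel) := by rw [cellLaw_eq_cloudLaw]
    obtain ⟨D, hDdef⟩ : ∃ D : ℝ, D = hellDiss (cloudLaw h δ p vel) := ⟨_, rfl⟩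
    rw [← hDdef] at hDeq
    have hD0' : 0 ≤ D := by rw [← hDeq]; exact hD0
    -- the cloud defect is `≤ ε + 1024 Lc (Mexp/R + D/κ) + 1024 η Mexp`
    have hcD : cloudDefect p vel ≤ ε + 1024 * Lc * (Mexp / R + D / κ) + 1024 * η * Mexp := by
      have hratio0 : 0 ≤ Mexp / R + D / κ := by positivity
      by_cases hgood : Mexp ≤ R ∧ D ≤ κ
      · have := hcell (N + 1) p vel hp0 hp1 hgood.1 (hDdef ▸ hgood.2)
        nlinarith [mul_nonneg hLc hratio0, mul_nonneg hη hMexp0]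
      · -- bad cell: `1 ≤ Mexp/R + D/κ`
        have hone : 1 ≤ Mexp / R + D / κ := by
          rcases not_and_or.1 hgood with h1 | h1
          · have : 1 ≤ Mexp / R := by rw [le_div_iff₀ hR]; linarith
            linarith [div_nonneg hD0' hκ.le]
          · have : 1 ≤ D / κ := by rw [le_div_iff₀ hκ]; linarith
            linarith [div_nonneg hMexp0 hR.le]
        have henv := cloudDefect_le (v := vel) hp0 hp1
        have hsum : ∑ i, p i * (1 + ‖vel i‖ ^ 6) ≤ Lc + η * Mexp := by
          calc ∑ i, p i * (1 + ‖vel i‖ ^ 6) ≤ ∑ i, p i * (Lc + η * Real.exp (lam * ‖vel i‖ ^ 2)) :=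
                Finset.sum_le_sum fun i _ => mul_le_mul_of_nonneg_left (hUI _) (hp0 i)
            _ = Lc + η * Mexp := by
                simp only [mul_add, Finset.sum_add_distrib, ← Finset.sum_mul, hp1, one_mul, hMexp, Finset.mul_sum]
                congr 1; exact Finset.sum_congr rfl fun i _ => by ring
        calc cloudDefect p vel ≤ 1024 * ∑ i, p i * (1 + ‖vel i‖ ^ 6) := henv
          _ ≤ 1024 * (Lc + η * Mexp) := by linarith
          _ = 1024 * Lc * 1 + 1024 * η * Mexp := by ring
          _ ≤ 1024 * Lc * (Mexp / R + D / κ) + 1024 * η * Mexp := by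
              nlinarith [mul_le_mul_of_nonneg_left hone (by positivity : (0 : ℝ) ≤ 1024 * Lc)]
          _ ≤ ε + 1024 * Lc * (Mexp / R + D / κ) + 1024 * η * Mexp := by linarith
    -- multiply by `ρ² ≤ ρ ρ_max`
    have hρρ : ρ ^ 2 ≤ ρmax * ρ := by rw [sq]; exact mul_le_mul_of_nonneg_right hcap hρ0
    have hcD0 : 0 ≤ cloudDefect p vel := cloudDefect_nonneg p vel
    rw [hEM, hDeq]
    calc ρ ^ 2 * cloudDefect p vel ≤ (ρmax * ρ) * cloudDefect p vel := mul_le_mul_of_nonneg_right hρρ hcD0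
      _ ≤ (ρmax * ρ) * (ε + 1024 * Lc * (Mexp / R + D / κ) + 1024 * η * Mexp) :=
          mul_le_mul_of_nonneg_left hcD (mul_nonneg hρmax hρ0)
      _ = ρmax * (ε * ρ + 1024 * (Lc / R + η) * (ρ * Mexp) + 1024 * Lc / κ * (ρ * D)) := by
          field_simp; ring

end Pointwise

/-! ## Integration along a good orbit -/

section Orbit

variable {σ : ℝ} {Φ : Flow σ N} {z : Cfg N} {γ C : ℝ} (hadm : AdmissibleKernel γ C ψ) (hz : z ∈ Φ.good)
  {h δ : ℝ} (hδ0 : 0 ≤ δ) (hδ1 : δ ≤ 1)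
include hadm hz hδ0 hδ1

/-- **THE PATHWISE BOUND** along a good orbit: under the density cap `ρ̄_s(x) ≤ ρ_max` on `[0, t]`, the cell closure
property and the UI split,
`∫₀ᵗ∫ₓ DefectSq ≤ ρ_max (ε t + 1024 (L_c/R + η) TE + (1024 L_c/κ) massDiss)`. -/
theorem setIntegral_defectSq_le {t : ℝ} (ht : 0 ≤ t) {ρmax ε R κ Lc η lam : ℝ} (hR : 0 < R) (hκ : 0 < κ)
    (hε : 0 ≤ ε) (hLc : 0 ≤ Lc) (hη : 0 ≤ η) (hρmax : 0 ≤ ρmax)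
    (hcap : ∀ s ∈ Icc 0 t, ∀ x, ((N + 1 : ℕ) : ℝ)⁻¹ * cW N ψ (Φ.flow s z) x ≤ ρmax)
    (hUI : ∀ v : V3, 1 + ‖v‖ ^ 6 ≤ Lc + η * Real.exp (lam * ‖v‖ ^ 2))
    (hcell : ∀ (n : ℕ) (p : Fin n → ℝ) (v : Fin n → V3), (∀ i, 0 ≤ p i) → ∑ i, p i = 1 →
      ∑ i, p i * Real.exp (lam * ‖v i‖ ^ 2) ≤ R → hellDiss (cloudLaw h δ p v) ≤ κ → cloudDefect p v ≤ ε) :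
    ∫ s in Icc 0 t, ∫ x, DefectSq σ N Φ ψ s z x ≤
      ρmax * (ε * t + 1024 * (Lc / R + η) *
          (∫ s in Icc 0 t, ∫ y, Real.exp (lam * ‖y.2‖ ^ 2) ∂(empiricalMeasure (Φ.flow s z))) +
        1024 * Lc / κ * massDiss σ N Φ ψ h δ t z) := by
  haveI := isFiniteMeasure_volume_T3
  have hsm := hadm.1
  have hψ0 := hadm.2.1
  have hψC := hadm.2.2.2.2.1
  have hψc : Continuous (ψ N) := (hsm N).continuous
  -- the four functions with genuine iterated integrals
  have hD := integrable_of_bdd t (fun s x => DefectSq σ N Φ ψ s z x) (measurable_defectSq hz hψc)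
    (bdd_defectSq hz (hψ0 N) (hψC N))
  have hRho := integrable_weightedDensity hz hψc hψ0 (hψC N) (g := fun _ => (1 : ℝ)) continuous_const (A := 1)
    (fun v _ => by simp) t
  have hEM := integrable_weightedDensity hz hψc hψ0 (hψC N) (g := fun v : V3 => Real.exp (lam * ‖v‖ ^ 2))
    (by fun_prop) (A := Real.exp (|lam| * vR z ^ 2)) (fun v hv => by
      rw [abs_of_pos (Real.exp_pos _), Real.exp_le_exp]
      have : ‖v‖ ^ 2 ≤ vR z ^ 2 := pow_le_pow_left₀ (norm_nonneg _) hv 2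
      calc lam * ‖v‖ ^ 2 ≤ |lam| * ‖v‖ ^ 2 := mul_le_mul_of_nonneg_right (le_abs_self _) (sq_nonneg _)
        _ ≤ |lam| * vR z ^ 2 := mul_le_mul_of_nonneg_left this (abs_nonneg _)) t
  have hMD := integrable_massDissDensity hz hψc hψ0 (hψC N) (h := h) hδ0 hδ1 t
  -- `ρ̄` in the `Σ · 1` shape of `hRho`
  have hρeq : ∀ (w : Cfg N) (x : T3), ((N + 1 : ℕ) : ℝ)⁻¹ * cW N ψ w x = ((N + 1 : ℕ) : ℝ)⁻¹ * ∑ i, cw N ψ w x i * 1 := by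
    intro w x; simp only [mul_one]; rfl
  have hρint : ∀ s, ∫ x, ((N + 1 : ℕ) : ℝ)⁻¹ * ∑ i, cw N ψ (Φ.flow s z) x i * 1 = 1 := by
    intro s
    rw [integral_weightedDensity hadm Φ s z]
    simp only [Finset.sum_const, Finset.card_univ, Fintype.card_fin, nsmul_eq_mul, mul_one]
    have hN : (((N + 1 : ℕ) : ℝ)) ≠ 0 := by positivity
    field_simp
  have hEMint : ∀ s, ∫ x, ((N + 1 : ℕ) : ℝ)⁻¹ * ∑ i, cw N ψ (Φ.flow s z) x i * Real.exp (lam * ‖(Φ.flow s z i).2‖ ^ 2) =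
      ∫ y, Real.exp (lam * ‖y.2‖ ^ 2) ∂(empiricalMeasure (Φ.flow s z)) := by
    intro s
    rw [integral_weightedDensity hadm Φ s z, integral_empiricalMeasure_real]
  -- the pointwise bound, in the syntactic shape of the four functions
  have hpt : ∀ s ∈ Icc 0 t, ∀ x, DefectSq σ N Φ ψ s z x ≤
      ρmax * (ε * (((N + 1 : ℕ) : ℝ)⁻¹ * ∑ i, cw N ψ (Φ.flow s z) x i * 1) +
        1024 * (Lc / R + η) * (((N + 1 : ℕ) : ℝ)⁻¹ * ∑ i, cw N ψ (Φ.flow s z) x i *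
          Real.exp (lam * ‖(Φ.flow s z i).2‖ ^ 2)) +
        1024 * Lc / κ * (((N + 1 : ℕ) : ℝ)⁻¹ * cW N ψ (Φ.flow s z) x * hellDiss (cellLaw N ψ h δ (Φ.flow s z) x))) := by
    intro s hs x
    have h1 := rho_sq_mul_cloudDefect_le hψ0 hδ0 hδ1 (Φ.flow s z) x hR hκ hε hLc hη hρmax (hcap s hs x) hUI hcell
    rw [defectSq_eq Φ ψ s z x hψ0, ← hρeq]
    exact h1
  -- integrate in `x`
  have hinner : ∀ s ∈ Icc 0 t, ∫ x, DefectSq σ N Φ ψ s z x ≤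
      ρmax * (ε * 1 + 1024 * (Lc / R + η) * (∫ y, Real.exp (lam * ‖y.2‖ ^ 2) ∂(empiricalMeasure (Φ.flow s z))) +
        1024 * Lc / κ * ∫ x, ((N + 1 : ℕ) : ℝ)⁻¹ * cW N ψ (Φ.flow s z) x *
          hellDiss (cellLaw N ψ h δ (Φ.flow s z) x)) := by
    intro s hs
    have i1 := (hRho.1 s hs).const_mul ε
    have i2 := (hEM.1 s hs).const_mul (1024 * (Lc / R + η))
    have i3 := (hMD.1 s hs).const_mul (1024 * Lc / κ)
    have hI : ∫ x, ρmax * (ε * (((N + 1 : ℕ) : ℝ)⁻¹ * ∑ i, cw N ψ (Φ.flow s z) x i * 1) +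
        1024 * (Lc / R + η) * (((N + 1 : ℕ) : ℝ)⁻¹ * ∑ i, cw N ψ (Φ.flow s z) x i *
          Real.exp (lam * ‖(Φ.flow s z i).2‖ ^ 2)) +
        1024 * Lc / κ * (((N + 1 : ℕ) : ℝ)⁻¹ * cW N ψ (Φ.flow s z) x * hellDiss (cellLaw N ψ h δ (Φ.flow s z) x))) =
        ρmax * (ε * 1 + 1024 * (Lc / R + η) * (∫ y, Real.exp (lam * ‖y.2‖ ^ 2) ∂(empiricalMeasure (Φ.flow s z))) +
          1024 * Lc / κ * ∫ x, ((N + 1 : ℕ) : ℝ)⁻¹ * cW N ψ (Φ.flow s z) x *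
            hellDiss (cellLaw N ψ h δ (Φ.flow s z) x)) := by
      rw [integral_const_mul ρmax, integral_add (i1.fun_add i2) i3, integral_add i1 i2, integral_const_mul ε,
        integral_const_mul (1024 * (Lc / R + η)), integral_const_mul (1024 * Lc / κ), hρint s, hEMint s]
    rw [← hI]
    exact integral_mono (hD.1 s hs) (((i1.fun_add i2).fun_add i3).const_mul ρmax) (hpt s hs)
  -- integrate in `s ∈ [0, t]`
  have hEMs : IntegrableOn (fun s => ∫ y, Real.exp (lam * ‖y.2‖ ^ 2) ∂(empiricalMeasure (Φ.flow s z))) (Icc 0 t) :=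
    hEM.2.congr (ae_of_all _ fun s => hEMint s)
  have j1 : IntegrableOn (fun _ : ℝ => ε * (1 : ℝ)) (Icc 0 t) := integrableOn_const (hs := measure_Icc_lt_top.ne)
  have j2 := hEMs.const_mul (1024 * (Lc / R + η))
  have j3 := hMD.2.const_mul (1024 * Lc / κ)
  have hO : ∫ s in Icc 0 t, ρmax * (ε * 1 + 1024 * (Lc / R + η) *
      (∫ y, Real.exp (lam * ‖y.2‖ ^ 2) ∂(empiricalMeasure (Φ.flow s z))) +
      1024 * Lc / κ * ∫ x, ((N + 1 : ℕ) : ℝ)⁻¹ * cW N ψ (Φ.flow s z) x * hellDiss (cellLaw N ψ h δ (Φ.flow s z) x)) =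
      ρmax * (ε * t + 1024 * (Lc / R + η) *
          (∫ s in Icc 0 t, ∫ y, Real.exp (lam * ‖y.2‖ ^ 2) ∂(empiricalMeasure (Φ.flow s z))) +
        1024 * Lc / κ * massDiss σ N Φ ψ h δ t z) := by
    rw [integral_const_mul ρmax, integral_add (j1.fun_add j2) j3, integral_add j1 j2,
      integral_const_mul (1024 * (Lc / R + η)), integral_const_mul (1024 * Lc / κ), setIntegral_const,
      Real.volume_real_Icc_of_le ht, sub_zero, smul_eq_mul]
    unfold massDiss
    ring
  rw [← hO]
  refine integral_mono_ae hD.2 (((j1.fun_add j2).fun_add j3).const_mul ρmax) ?_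
  exact (ae_restrict_iff' measurableSet_Icc).2 (ae_of_all _ hinner)

end Orbit

end EEP

/-- Registered anchor of this helper file: the uniform-integrability split of the sixth velocity moment,
`∀ λ > 0, ∀ η > 0, ∃ L_c ≥ 0, ∀ v, 1 + |v|⁶ ≤ L_c + η e^{λ|v|²}` (`EEP.exists_ui_split`). -/
theorem bhEEPClosure_pointwise_anchor : ∀ (lam : ℝ), 0 < lam → ∀ (η : ℝ), 0 < η → ∃ Lc : ℝ, 0 ≤ Lc ∧ ∀ v : V3, 1 + ‖v‖ ^ 6 ≤ Lc + η * Real.exp (lam * ‖v‖ ^ 2) :=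
  fun _ hlam _ hη => EEP.exists_ui_split hlam hη

end

end Summit.AtomisticToContinuum.HydrodynamicLimit.Theorems.BlockHDissipation
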